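import Summits.BirchSwinnertonDyer.Rank1Residual.Additive.LevelToLayerZero
import Summits.BirchSwinnertonDyer.Rank1Residual.Additive.StrictSignedSelmerLayerZero
import Literature.NumberTheory.GaloisRepresentations.AbsGaloisGroupProofs
import HarnessLib

/-!
# Local triviality is inherited UP A TOWER of `K`-fields (any two chosen decomposition groups are
# conjugate), and a class locally trivial at `E` satisfies EVERY Kummer condition at `E` over the
# `ℤ_p`-tower — the vocabulary BRIDGE, part 3 (cell `b2b-bsdres`, CLASS-CLOSURE lane, class O10 —
# x1b GEN 38, class lead; file 73 of the series)

HONEST FRAMING (cell `b2b-bsdres`, run/shared/lean/b2b/bsd-rank1-residual/, verbatim in every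
file): the goal of the cell is to DELETE the COMBINATION-SHAPED residual classes of the
Birch–Swinnerton-Dyer formula for ALL analytic-rank `≤ 1` elliptic curves over `ℚ` — "full BSD
formula for every rank `≤ 1` curve in class `C`" assembled STRICTLY from published theorems — so
that the rank-`≤ 1` remainder becomes exactly the CONSTRUCTION-SHAPED classes, which are TYPED
(missing-input `Prop`s), NOT attempted. This is not "finishing BSD". CLASS-CLOSURE lane: prove
what is provable now; shrink each hard class to its core with data; no claim beyond stated classes;
research routes on CONSTRUCTION-SHAPED X12 / O10; census / instrument output = EVIDENCE / conjecture
items, NEVER a Literature fact; `RESIDUAL-MAP.md` marks change only by signed lines. THIS FILE: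
TOOL THEOREMS ONLY — no definition, no named Literature fact, no Summits-side fact `def … : Prop`,
no `sorry`, axioms standard; pure Galois-cohomology bookkeeping over ANY field `K`, any prime `p`,
any `ℤ_p`-extension `κ`, any level `p^m`; nothing is booked; no label / mark / count / sub-cell
moves; (C1_η), (C2_η-GZ), (C3_η) stay typed as filed (cc-typer-6's pen); O10 stays OPEN /
CONSTRUCTION-SHAPED; nothing about `BSD(W, p)` of any pair is claimed.

## Why

The (C3_η) objects `A₀ ≥ S₀` (files 42–59) carry their local condition at `p` at an ABSTRACT model
`E` of the completion (`E = ℚ_[p]`, where Kobayashi's theory is typed), while a Selmer structure on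
`E[p^m]` (the count (C), files 63–70) carries its condition at `v₀` in `H¹(K_{v₀}, E[p^m])`,
`K_{v₀} = v₀.adicCompletion K`.  The two restriction maps `Γ_E → Γ_K`, `Γ_{K_{v₀}} → Γ_K` use two
CHOSEN embeddings of `K̄`; along a `K`-algebra map `K_{v₀} → E` (e.g. Mathlib's `padicEquiv`) their
images are CONJUGATE decomposition groups (the tree's `absGaloisRestrict_isConj_of_algHom_holds`), and
LOCAL TRIVIALITY of a class of `H¹(K, M)` does not see the difference (§1–§3).  §4: a class of
`H¹(K, E[p^m])` locally trivial at `E` satisfies the Kummer condition `localKummerOverOfEmb W p H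
(closureEmb E) A` of the `ℤ_p`-tower files for EVERY subgroup `A` and every `H ≤ Γ_K` (its cocycle is
the coboundary of a `p^m`-torsion point on `Γ_E`) — the locality input of file 72 §2.

## What (all kernel theorems)

* §1 `apply_conj_eq_smul_sub` — crossed homomorphisms: if `φ(d) = d·T − T` on a set `S ⊆ G` then
  `φ(τ⁻¹ d τ) = (τ⁻¹ d τ)·X − X` on `τ⁻¹ S τ` with `X = τ⁻¹·T − φ(τ⁻¹)`.
* §2 `exists_resGal_resGal_eq_conj` — for `K`-fields `E' → E`: `∃ τ ∈ Γ_K, ∀ σ ∈ Γ_E,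
  res_{E'}(res^{E'}_E σ) = τ · res_E σ · τ⁻¹` (`absGaloisRestrict_isConj_of_algHom_holds`).
* §3 **`res_{E'} c = 0 ⟹ res_E c = 0`** for `c ∈ H¹(K, M)`, any discrete `Γ_K`-module given by a
  `DistribMulAction` with open stabilisers (`LocBridge.ofSMul`; `E[n]`, `E[p^∞]`), along any
  `K`-algebra map `E' → E` (X11b `LocBridge.res_ofSMul_eq_zero_iff` + §1 + §2); for a number field:
  `loc_{v₀} c = 0 ⟹ res_E c = 0` given `K_{v₀} → E`, and `res_E c = 0 ⟹ loc_{v₀} c = 0` given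
  `E → K_{v₀}`.
* §4 **`res_E c = 0 ⟹ res_H ((E[p^m] ↪ E[p^∞])_* c) ∈ localKummerOverOfEmb W p H (closureEmb E) A`**
  for every `H ≤ Γ_K` and every `A ≤ E(K̄_E)`; at `H = κ⁻¹(p⁰ℤ_p)`: `Ψ_m c`; at `H = ker κ`:
  `h_0 (Ψ_m c)` and all its `Γ_K`-conjugates (`h_0 ∘ Ψ_m = res_{ker κ} ∘ (E[p^m] ↪ E[p^∞])_*`).

References: [SerreGaloisCohomology1997] I.§2.3–2.5 (conjugation acts trivially on `H¹`), I.§5.1,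
II.§1.1; [MilneFT2022] Ch. 7 (restriction well defined up to conjugacy); [GreenbergLNM1716] §2–§3;
[Kobayashi2003] Def. 1.1, Def. 2.1.
-/

noncomputable section

open scoped Classical

open WeierstrassCurve Literature.NumberTheory.EllipticCurves Literature.NumberTheory.GaloisRepresentations
  NumberField IsDedekindDomain Field
open Literature.NumberTheory.EllipticCurves.Kobayashi2003
open Summit.BirchSwinnertonDyer.Rank1Residual.X11b.Levels
open Summit.BirchSwinnertonDyer.Rank1Residual.X11b
open scoped ContRepresentation

namespace Summit.BirchSwinnertonDyer.Rank1Residual.Additive.LevelBridge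

universe u

/-! ### §1 Crossed homomorphisms: principal on `S` ⟹ principal on `τ⁻¹ S τ` -/

section Cocycle

variable {G : Type u} [Group G] [TopologicalSpace G] [IsTopologicalGroup G]
  {M : Type u} [AddCommGroup M] [DistribMulAction G M] [TopologicalSpace M] [DiscreteTopology M]

omit [IsTopologicalGroup G] in
/-- The crossed-homomorphism identity of a continuous `1`-cocycle of the discrete `G`-module `M`:
`φ (g h) = φ g + g • φ h`. [folklore] -/
theorem contOneCocycles_apply_mul (φ : contOneCocycles (discreteTopRep G M)) (g h : G) :
    φ.1 (g * h) = φ.1 g + g • φ.1 h :=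
  φ.2 g h

omit [IsTopologicalGroup G] in
/-- `φ τ = −τ • φ τ⁻¹` for a `1`-cocycle (`φ 1 = 0`). [folklore] -/
theorem contOneCocycles_apply_eq_neg_smul_apply_inv (φ : contOneCocycles (discreteTopRep G M))
    (τ : G) : φ.1 τ = -(τ • φ.1 τ⁻¹) := by
  have h := contOneCocycles_apply_mul φ τ τ⁻¹
  rw [mul_inv_cancel, contOneCocycles.apply_one] at h
  rw [eq_neg_iff_add_eq_zero, h]

omit [IsTopologicalGroup G] in
/-- **A cocycle principal on `S` is principal on `τ⁻¹ S τ`**: if `φ d = d • T − T` for `d ∈ S` then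
`φ (τ⁻¹ d τ) = (τ⁻¹ d τ) • X − X` with `X = τ⁻¹ • T − φ τ⁻¹` (inner automorphisms act trivially on
`H¹`, at the level of one cocycle). [cite: SerreGaloisCohomology1997, I.§2.3 and I.§5.1] -/
theorem apply_conj_eq_smul_sub (φ : contOneCocycles (discreteTopRep G M)) {S : Set G} {T : M}
    (hT : ∀ d ∈ S, φ.1 d = d • T - T) (τ : G) {d : G} (hd : d ∈ S) :
    φ.1 (τ⁻¹ * d * τ) = (τ⁻¹ * d * τ) • (τ⁻¹ • T - φ.1 τ⁻¹) - (τ⁻¹ • T - φ.1 τ⁻¹) := by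
  rw [contOneCocycles_apply_mul, contOneCocycles_apply_mul, hT d hd,
    contOneCocycles_apply_eq_neg_smul_apply_inv φ τ, smul_sub, smul_sub, smul_neg, ← mul_smul,
    ← mul_smul, ← mul_smul, mul_assoc (τ⁻¹ * d) τ τ⁻¹, mul_inv_cancel, mul_one]
  abel

end Cocycle

/-! ### §2 Two chosen restrictions along a tower are conjugate -/

section Conj

variable (K : Type u) [Field K] (E' : Type u) [Field E'] [Algebra K E'] (E : Type u) [Field E]
  [Algebra K E] [Algebra E' E] [IsScalarTower K E' E]

/-- **`res_{E'} ∘ res^{E'}_E` is conjugate to `res_E`**: for `K`-fields `E' → E` there is `τ ∈ Γ_K`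
with `resGal E' (resGal^{E'} E σ) = τ · resGal E σ · τ⁻¹` for all `σ ∈ Γ_E` — both are restrictions
along `K`-embeddings `K̄ → Ē` (`closureEmb^{E'} E ∘ closureEmb E'` and `closureEmb E`), which differ
by an element of `Γ_K` (`absGaloisRestrict_isConj_of_algHom_holds`; `resGal = absGaloisRestrict`).
[cite: MilneFT2022, Ch. 7 (the absolute Galois group: restriction well defined up to conjugacy)] -/
theorem exists_resGal_resGal_eq_conj :
    ∃ τ : absoluteGaloisGroup K, ∀ σ : absoluteGaloisGroup E,
      resGal (K := K) E' (resGal (K := E') E σ) = τ * resGal (K := K) E σ * τ⁻¹ := by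
  refine absGaloisRestrict_isConj_of_algHom_holds K E
    (((absClosureEmbedding E' E).restrictScalars K).comp (absClosureEmbedding K E'))
    (fun σ ↦ absGaloisRestrict K E' (absGaloisRestrict E' E σ)) (fun σ x ↦ ?_)
  change absClosureEmbedding E' E (absClosureEmbedding K E' (_ • x)) =
    σ • absClosureEmbedding E' E (absClosureEmbedding K E' x)
  rw [absGaloisRestrict_apply_smul, absGaloisRestrict_apply_smul]

end Conj

/-! ### §3 Local triviality goes up a tower of `K`-fields -/

section Tower

variable {K : Type u} [Field K] (E' : Type u) [Field E'] [Algebra K E'] (E : Type u) [Field E]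
  [Algebra K E] [Algebra E' E] [IsScalarTower K E' E]
variable {M : Type u} [AddCommGroup M] [DistribMulAction (absoluteGaloisGroup K) M]
  [TopologicalSpace M] [DiscreteTopology M]

/-- **`res_{E'} c = 0 ⟹ res_E c = 0` along a `K`-algebra map `E' → E`**, for a class `c` of
`H¹(K, M)` of a discrete `Γ_K`-module (`LocBridge.ofSMul`).  A cocycle of `c` is principal on the
decomposition group `res_{E'}(Γ_{E'})` (`LocBridge.res_ofSMul_eq_zero_iff`,
`resSubgroup_oneCocycleClass_eq_zero_iff`); `res_E(Γ_E)` lies in a conjugate of it (§2); and a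
cocycle principal on `S` is principal on `τ⁻¹ S τ` (§1).
[cite: SerreGaloisCohomology1997, I.§2.3–2.5 and II.§1.1] -/
theorem res_eq_zero_of_res_eq_zero_tower
    (hM : ∀ m : M, IsOpen {σ : absoluteGaloisGroup K | σ • m = m})
    (c : galoisCohomology (LocBridge.ofSMul M hM) 1)
    (h : galoisCohomology.res (LocBridge.ofSMul M hM) E' 1 c = 0) :
    galoisCohomology.res (LocBridge.ofSMul M hM) E 1 c = 0 := by
  rw [LocBridge.res_ofSMul_eq_zero_iff] at h ⊢
  obtain ⟨φ, hφ⟩ := oneCocycleClass_surjective (discreteTopRep (absoluteGaloisGroup K) M)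
    (LocBridge.toDiscreteH1 hM c)
  rw [← hφ, LocBridge.resSubgroup_oneCocycleClass_eq_zero_iff] at h ⊢
  obtain ⟨T, hT⟩ := h
  obtain ⟨τ, hτ⟩ := exists_resGal_resGal_eq_conj K E' E
  refine ⟨τ⁻¹ • T - φ.1 τ⁻¹, fun g hg ↦ ?_⟩
  obtain ⟨σ, rfl⟩ := MonoidHom.mem_range.mp hg
  have hσ : (absGaloisRestrict K E).toMonoidHom σ =
      τ⁻¹ * resGal (K := K) E' (resGal (K := E') E σ) * τ := by
    rw [hτ σ]
    change resGal (K := K) E σ = _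
    group
  rw [hσ]
  exact apply_conj_eq_smul_sub φ hT τ (MonoidHom.mem_range.mpr ⟨resGal (K := E') E σ, rfl⟩)

variable (W : WeierstrassCurve K)

/-- `res_{E'} c = 0 ⟹ res_E c = 0` for `c ∈ H¹(K, E[n])` (`W.torsionGaloisModule n = ofSMul E[n] _`
definitionally). [cite: SerreGaloisCohomology1997, I.§2.3–2.5 and II.§1.1] -/
theorem res_torsionGaloisModule_eq_zero_of_tower (n : ℤ)
    (c : galoisCohomology (W.torsionGaloisModule n) 1)
    (h : galoisCohomology.res (W.torsionGaloisModule n) E' 1 c = 0) :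
    galoisCohomology.res (W.torsionGaloisModule n) E 1 c = 0 :=
  res_eq_zero_of_res_eq_zero_tower E' E (LocBridge.isOpen_stabilizer_geomTorsion' W n) c h

/-- `res_{E'} c = 0 ⟹ res_E c = 0` for `c ∈ H¹(K, E[p^∞])` (`LocBridge.primaryGaloisModule W p =
ofSMul E[p^∞] _`). [cite: SerreGaloisCohomology1997, I.§2.3–2.5 and II.§1.1] -/
theorem res_primaryGaloisModule_eq_zero_of_tower (p : ℕ)
    (c : galoisCohomology (LocBridge.primaryGaloisModule W p) 1)
    (h : galoisCohomology.res (LocBridge.primaryGaloisModule W p) E' 1 c = 0) :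
    galoisCohomology.res (LocBridge.primaryGaloisModule W p) E 1 c = 0 :=
  res_eq_zero_of_res_eq_zero_tower E' E (LocBridge.isOpen_stabilizer_geomPrimaryTorsion W p) c h

end Tower

section Place

variable {K : Type u} [Field K] [NumberField K] (W : WeierstrassCurve K) (n : ℤ)
  (v₀ : HeightOneSpectrum (𝓞 K)) (E : Type u) [Field E] [Algebra K E]

/-- **`loc_{v₀} c = 0 ⟹ res_E c = 0`** for `c ∈ H¹(K, E[n])` and a `K`-algebra map `K_{v₀} → E` from
the completion (`loc_{v₀} = res_{K_{v₀}}` definitionally). For `K = ℚ`, `E = ℚ_[p]` the map is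
Mathlib's `padicEquiv`. [cite: SerreGaloisCohomology1997, II.§1.1] -/
theorem res_eq_zero_of_localization_eq_zero [Algebra (v₀.adicCompletion K) E]
    [IsScalarTower K (v₀.adicCompletion K) E]
    (c : galoisCohomology (W.torsionGaloisModule n) 1)
    (h : galoisCohomology.localization (W.torsionGaloisModule n) (Sum.inr v₀) 1 c = 0) :
    galoisCohomology.res (W.torsionGaloisModule n) E 1 c = 0 :=
  res_torsionGaloisModule_eq_zero_of_tower (v₀.adicCompletion K) E W n c h

/-- **`res_E c = 0 ⟹ loc_{v₀} c = 0`** for `c ∈ H¹(K, E[n])` and a `K`-algebra map `E → K_{v₀}` into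
the completion. [cite: SerreGaloisCohomology1997, II.§1.1] -/
theorem localization_eq_zero_of_res_eq_zero [Algebra E (v₀.adicCompletion K)]
    [IsScalarTower K E (v₀.adicCompletion K)]
    (c : galoisCohomology (W.torsionGaloisModule n) 1)
    (h : galoisCohomology.res (W.torsionGaloisModule n) E 1 c = 0) :
    galoisCohomology.localization (W.torsionGaloisModule n) (Sum.inr v₀) 1 c = 0 :=
  res_torsionGaloisModule_eq_zero_of_tower E (v₀.adicCompletion K) W n c h

end Place

/-! ### §4 A class locally trivial at `E` satisfies every Kummer condition at `E` over the tower -/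

section Kummer

variable {K : Type u} [Field K] (W : WeierstrassCurve K) (p : ℕ) [hp : Fact p.Prime] (m : ℕ)
  (E : Type u) [Field E] [Algebra K E]

omit hp in
/-- A class `c ∈ H¹(K, E[p^m])` with `res_E c = 0` has, for any cocycle `φ₀`, a point `T ∈ E[p^m]`
with `φ₀ g = g • T − T` on the decomposition group `resGal E (Γ_E)`. [cite: SerreGaloisCohomology1997, I.§5.1 and II.§1.1] -/
theorem exists_apply_eq_smul_sub_of_res_eq_zero
    (φ₀ : contOneCocycles
      (discreteTopRep (absoluteGaloisGroup K) (geomTorsion W ((p ^ m : ℕ) : ℤ))))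
    (h : galoisCohomology.res (W.torsionGaloisModule ((p ^ m : ℕ) : ℤ)) E 1
      (oneCocycleClass _ φ₀) = 0) :
    ∃ T : geomTorsion W ((p ^ m : ℕ) : ℤ), ∀ σ : absoluteGaloisGroup E,
      φ₀.1 (resGal (K := K) E σ) = resGal (K := K) E σ • T - T := by
  -- `W.torsionGaloisModule n = LocBridge.ofSMul E[n] _` and `toDiscreteH1 = id` definitionally
  have h1 := (LocBridge.res_ofSMul_eq_zero_iff
    (LocBridge.isOpen_stabilizer_geomTorsion' W ((p ^ m : ℕ) : ℤ)) E (oneCocycleClass _ φ₀)).mp h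
  obtain ⟨T, hT⟩ := (LocBridge.resSubgroup_oneCocycleClass_eq_zero_iff _ φ₀).mp h1
  exact ⟨T, fun σ ↦ hT _ (MonoidHom.mem_range.mpr ⟨σ, rfl⟩)⟩

omit hp in
/-- **`res_E c = 0 ⟹ res_H ((E[p^m] ↪ E[p^∞])_* c)` satisfies the Kummer condition
`localKummerOverOfEmb W p H (closureEmb E) A` for EVERY `A ≤ E(K̄_E)` and every `H ≤ Γ_K`**: a cocycle
of `c` is `σ ↦ σT − T` on `resGal E (Γ_E) ⊇ resGal E (H_E)` with `T ∈ E[p^m]`, so the Kummer witness is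
`Q = ι(T)`, `p^m Q = 0 ∈ A`. [cite: Kobayashi2003, Def. 1.1 and Def. 2.1 (p. 5)]
[cite: GreenbergLNM1716, §2 (pp. 62–63)] -/
theorem resH1Hom_subgroupIncl_map_mem_localKummerOverOfEmb_of_res_eq_zero
    (H : Subgroup (absoluteGaloisGroup K)) (A : AddSubgroup (localPoints W E))
    (c : galoisCohomology (W.torsionGaloisModule ((p ^ m : ℕ) : ℤ)) 1)
    (hc : galoisCohomology.res (W.torsionGaloisModule ((p ^ m : ℕ) : ℤ)) E 1 c = 0) :
    resH1Hom (subgroupIncl H) (AddMonoidHom.id (geomPrimaryTorsion W p)) (fun _ _ ↦ rfl)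
        (galoisCohomology.map (primaryInclusion W p m) 1 c) ∈
      localKummerOverOfEmb W p H (closureEmb (K := K) E) A := by
  obtain ⟨φ₀, rfl⟩ := oneCocycleClass_surjective _ c
  obtain ⟨T, hT⟩ := exists_apply_eq_smul_sub_of_res_eq_zero W p m E φ₀ hc
  -- the cocycle of `res_H ((E[p^m] ↪ E[p^∞])_* [φ₀])` is `t ↦ ι(φ₀ t)` (two pull-backs)
  rw [galoisCohomology.map_one_oneCocycleClass]
  erw [map_oneCocycleClass]
  refine ⟨_, pointsMapOfEmb W (closureEmb (K := K) E) ((T : geomTorsion W _) : geomPoints W), m,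
    rfl, ?_, fun τ ↦ ?_⟩
  · have h0 : p ^ m • pointsMapOfEmb W (closureEmb (K := K) E)
        ((T : geomTorsion W _) : geomPoints W) = 0 := by
      rw [← map_nsmul, ← AddSubgroupClass.coe_nsmul, pow_nsmul_geomTorsion_eq_zero W p m T,
        ZeroMemClass.coe_zero, map_zero]
    rw [h0]
    exact zero_mem A
  · have hτ : ((φ₀.1 (resGalOfEmb (closureEmb (K := K) E) (τ : absoluteGaloisGroup E)) :
        geomTorsion W _) : geomPoints W) =
        resGalOfEmb (closureEmb (K := K) E) (τ : absoluteGaloisGroup E) • ((T : geomTorsion W _) :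
          geomPoints W) - ((T : geomTorsion W _) : geomPoints W) := by
      have h := hT (τ : absoluteGaloisGroup E)
      rw [resGal_eq] at h
      rw [h, AddSubgroupClass.coe_sub, Literature.NumberTheory.EllipticCurves.AddSubgroup.torsionBy.coe_smul]
    change pointsMapOfEmb W (closureEmb (K := K) E)
        ((φ₀.1 (resGalOfEmb (closureEmb (K := K) E) (τ : absoluteGaloisGroup E)) :
          geomTorsion W _) : geomPoints W) = _
    rw [hτ, map_sub, pointsMapOfEmb_smul]

variable (κ : ZpExtension K p)

/-- At `H = κ⁻¹(p⁰ℤ_p)`: **`res_E c = 0 ⟹ Ψ_m c ∈ localKummerOverOfEmb W p (κ.layerSubgroup 0)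
(closureEmb E) A`** for every `A` — e.g. the level-`0` strict signed condition at `E`.
[cite: Kobayashi2003, Def. 2.1 (p. 5)] -/
theorem levelToLayerZero_mem_localKummerOverOfEmb_of_res_eq_zero (A : AddSubgroup (localPoints W E))
    (c : galoisCohomology (W.torsionGaloisModule ((p ^ m : ℕ) : ℤ)) 1)
    (hc : galoisCohomology.res (W.torsionGaloisModule ((p ^ m : ℕ) : ℤ)) E 1 c = 0) :
    resH1Hom (subgroupIncl (κ.layerSubgroup 0)) (AddMonoidHom.id (geomPrimaryTorsion W p))
        (fun _ _ ↦ rfl) (galoisCohomology.map (primaryInclusion W p m) 1 c) ∈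
      localKummerOverOfEmb W p (κ.layerSubgroup 0) (closureEmb (K := K) E) A :=
  resH1Hom_subgroupIncl_map_mem_localKummerOverOfEmb_of_res_eq_zero W p m E _ A c hc

/-- **`h_0 ∘ Ψ_m = res_{ker κ} ∘ (E[p^m] ↪ E[p^∞])_*`**: restricting to `κ⁻¹(p⁰ℤ_p)` and then to
`ker κ` is restricting to `ker κ` (functoriality, `resH1Hom_resH1Hom`). [folklore] -/
theorem layerToInfty_levelToLayerZero_eq (x : W.galH1Primary p) :
    W.layerToInfty κ 0 (resH1Hom (subgroupIncl (κ.layerSubgroup 0))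
        (AddMonoidHom.id (geomPrimaryTorsion W p)) (fun _ _ ↦ rfl) x) =
      resH1Hom (subgroupIncl κ.kerSubgroup) (AddMonoidHom.id (geomPrimaryTorsion W p))
        (fun _ _ ↦ rfl) x := by
  change resH1Hom (subgroupInclusion (κ.kerSubgroup_le_layerSubgroup 0))
      (AddMonoidHom.id (geomPrimaryTorsion W p)) (fun _ _ ↦ rfl) (resH1Hom _ _ _ x) = _
  rw [resH1Hom_resH1Hom]
  exact DFunLike.congr_fun (resH1Hom_congr (by ext; rfl) (by ext; rfl) _ _) x

/-- At `H = ker κ`: **`res_E c = 0 ⟹ h_0 (Ψ_m c) ∈ localKummerOverOfEmb W p (ker κ) (closureEmb E) A`**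
for every `A` — e.g. the level-`∞` (strict) signed condition `⨆_n E^{ε,str}(K_n·E)`.
[cite: Kobayashi2003, Def. 2.1 (p. 5) and §9] -/
theorem layerToInfty_levelToLayerZero_mem_localKummerOverOfEmb_of_res_eq_zero
    (A : AddSubgroup (localPoints W E))
    (c : galoisCohomology (W.torsionGaloisModule ((p ^ m : ℕ) : ℤ)) 1)
    (hc : galoisCohomology.res (W.torsionGaloisModule ((p ^ m : ℕ) : ℤ)) E 1 c = 0) :
    W.layerToInfty κ 0 (resH1Hom (subgroupIncl (κ.layerSubgroup 0))
        (AddMonoidHom.id (geomPrimaryTorsion W p)) (fun _ _ ↦ rfl)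
        (galoisCohomology.map (primaryInclusion W p m) 1 c)) ∈
      localKummerOverOfEmb W p κ.kerSubgroup (closureEmb (K := K) E) A := by
  rw [layerToInfty_levelToLayerZero_eq]
  exact resH1Hom_subgroupIncl_map_mem_localKummerOverOfEmb_of_res_eq_zero W p m E _ A c hc

/-- The same for every `Γ_K`-conjugate (the conjugation action fixes `h_0`-images, n1011
`conjH1_layerToInfty_zero`): **`res_E c = 0 ⟹ Ψ_m c ∈ (⨅_σ conj_σ⁻¹ localKummerOverOfEmb W p (ker κ)
(closureEmb E) A) ∘ h_0`** — the "signed part" of `Sel^{loc,∞}` (files 42–59) for every `A`.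
[cite: Kobayashi2003, Def. 2.1 (p. 5) and §9] -/
theorem levelToLayerZero_mem_comap_iInf_localKummerOverOfEmb_of_res_eq_zero [NumberField K]
    (A : AddSubgroup (localPoints W E))
    (c : galoisCohomology (W.torsionGaloisModule ((p ^ m : ℕ) : ℤ)) 1)
    (hc : galoisCohomology.res (W.torsionGaloisModule ((p ^ m : ℕ) : ℤ)) E 1 c = 0) :
    resH1Hom (subgroupIncl (κ.layerSubgroup 0)) (AddMonoidHom.id (geomPrimaryTorsion W p))
        (fun _ _ ↦ rfl) (galoisCohomology.map (primaryInclusion W p m) 1 c) ∈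
      (⨅ σ : absoluteGaloisGroup K,
        (localKummerOverOfEmb W p κ.kerSubgroup (closureEmb (K := K) E) A).comap
          (W.conjH1 p κ.kerSubgroup σ)).comap (W.layerToInfty κ 0) := by
  rw [AddSubgroup.mem_comap, AddSubgroup.mem_iInf]
  intro σ
  rw [AddSubgroup.mem_comap, conjH1_layerToInfty_zero]
  exact layerToInfty_levelToLayerZero_mem_localKummerOverOfEmb_of_res_eq_zero W p m E κ A c hc

end Kummer

end Summit.BirchSwinnertonDyer.Rank1Residual.Additive.LevelBridge

end
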